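import Summits.QuantumFields.BalabanUV.T4Continuum.Support.VariationalColourTaxiTowerCentredEndData

/-!
# T⁴ programme, spine node NE2 (U1a), lane P2 — «V-AVG-G AT TAXI DATA», file 12: THE TWO VECTOR ENDs AT BAŁABAN's TAXI DATA FOR ALL SUFFICIENTLY SMALL CLASS
# CONSTANTS — the twelve displayed numeric smallness lines of files 10 ∕ 11 hold on a neighbourhood of `(c, α, λ) = 0`, so ONE threshold `c₀(d, L) > 0`
# replaces them (model level; cell `pub-balaban`)

NE2 formalisation swarm `b2b-balaban-t4-ne2-formalise-*`, leaf prover 10 GEN 6 (`prover-b2b-balaban-t4-ne2-formalise-leaf-10-g6-0`, V-END holder lineage); item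
«V-AVG-G AT TAXI DATA», file 12 (ONLINE l.24052; the generic form of leaf-04-g8's `WilsonLineTowerCosineEnd.cosA_numeric_eventually`, which does the same
for ONE data family).  Composition BY NAME of file 10 `VariationalColourTaxiTowerProjGRateData.towerLimitRate_effV_taxiTower_projG_of_data` and file 11
`VariationalColourTaxiTowerCentredEndData.effV_tendsto_taxiTower_projG_of_data`; the only mathematics is the continuity at `0` of the twelve left-hand sides
as functions of `(c, α, λ) ∈ ℝ³` (polynomials, `√·`, `max`, the constants `Cst d 1`, `36^d`; `deltaGap d 1 0 0 0 0 = 0`).  Nothing defined.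

THE STATEMENTS.
 * §1 `eventually_le_of_continuous₃` ∕ `eventually_lt_of_continuous₃` ([folklore]: a continuous `f : ℝ × ℝ × ℝ → ℝ` with `f 0 = 0` is eventually `≤ K` ∕ `< K`
   near `0` for `0 < K`), **`numeric_lines_eventually`** (the twelve lines of files 10 ∕ 11 — `hsm1`–`hsm7`, `hsmV`, `hsmG`, `hsmallδ`, `hsmallQ` and
   p241220's strict line — hold `∀ᶠ (c, α, λ) in 𝓝 0`), **`numeric_lines_of_small`**: `∃ c₀ > 0, ∀ c α λ, |c| < c₀ → |α| < c₀ → |λ| < c₀ →` the twelve lines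
   (`Metric.eventually_nhds_iff` + the sup distance on `ℝ × ℝ × ℝ`).  `c₀` depends on `(d, L)` only; it EXISTS by continuity and is NOT made explicit
   (file 10's lines are the explicit form; memo VEND v1.7 records their sizes: at `d = 2` the binding lines are `c ≲ 3.5·10⁻¹⁴`, `α ≲ 7.1·10⁻¹³`).
 * §2 **`towerLimitRate_effV_taxiTower_projG_of_small`**: for `2 ≤ L`, `1 ≤ d` there is `c₀ > 0` such that for EVERY torus `M` (`1 < M_μ`), every coherent tower
   of unitary one-step bond operators in the plaquette class `(L^{k+1})²b_k ≤ c`, every regular presentation `(ar_k, ℓr_k)` of `Rlev k` with classes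
   `L^k·ar_k ≤ α`, `(L^k)²·ℓr_k ≤ λ`, with `c, α, λ < c₀`, every `aa > 0` and every rate `θ ∈ [L^{−1∕2}, 1)`: `∃ C, TowerLimitRate 1 1 (k ↦ effV (L^k) M (Rlev k)
   (GmProj … ker Q_{taxi,k}) (QmL (nestLv k)) aa) C θ` — the vector END WITH RATE at Bałaban's taxi data with NO numeric line displayed.
 * §3 **`effV_tendsto_taxiTower_projG_of_small`**: the same threshold gives the EXISTENCE END (limit exists, Hermitian, nonnegative form, block-spin values
   converge) for every such tower with `c, α, λ < c₀` and `aa > 0`.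
The lower bounds `0 ≤ c`, `0 ≤ α`, `0 ≤ λ` are not assumed: they follow from the data (`b_k`, `ar_k`, `ℓr_k` dominate norms).

HONEST FRAMING (T4-DAG p. 1).  Real analysis (continuity at a point) + composition of landed theorems at MODEL level (c5, `E = ℂ`; taxi ∕ straight contours OURS;
no B0); [folklore]; nothing printed is a hypothesis.  The threshold `c₀` is EXISTENTIAL here (its explicit avatars are files 10 ∕ 11's lines, quantitatively void:
memo VEND v1.7 NUMBERS); memo VGF (V2′)'s located caveat untouched.  V-END with background in Bałaban's (1.1)–(1.3) flow ∕ NE2 NOT proved; NE3 OPEN; spine PROVED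
0∕9 unchanged; rung (B)+1 on a fixed finite T⁴ — NOT infinite volume, NOT mass gap, NOT Clay.  No `def`, no `def … : Prop`, no `sorry`; axioms standard.
HONEST DEPENDENCY (cell, verbatim): continuum YM on T⁴ ⇐ BetaPertH ∧ nine spine estimates (0/9 proved); BetaPertH ⇐ (D1) ∧ (D4) ∧ CAP+tail; G-an2-4 gates
asym, D1 and NE2/3/4.
-/

noncomputable section

namespace Summit.QuantumFields.BalabanUV.T4Continuum.VariationalColourTaxiTowerEndSmall

open Filter Finset
open scoped Matrix ComplexOrder BigOperators Topology
open Literature.MathematicalPhysics.QuantumFieldTheory.Balaban1983to89.B5Prop11Plancherel (Tor fine unitVec Cst)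
open Literature.Analysis.Complex (qform)
open Summit.QuantumFields.BalabanUV.T4Continuum.VariationalTransfer (blockSpin)
open Summit.QuantumFields.BalabanUV.T4Continuum.VariationalColourTower (Rtrv)
open Summit.QuantumFields.BalabanUV.T4Continuum.VariationalColourTaxiTransport
open Summit.QuantumFields.BalabanUV.T4Continuum.CovariantAveragingTower (TowerLimitRate)
open Summit.QuantumFields.BalabanUV.T4Continuum.VectorBlockTrialForm (nsqV QvL)
open Summit.QuantumFields.BalabanUV.T4Continuum.VariationalVectorForm (ScV lamV)
open Summit.QuantumFields.BalabanUV.T4Continuum.VariationalVectorEffective (unc effV)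
open Summit.QuantumFields.BalabanUV.T4Continuum.VariationalVectorTower (QmL)
open Summit.QuantumFields.BalabanUV.T4Continuum.VariationalVectorGaugeSlice (avgOp projG)
open Summit.QuantumFields.BalabanUV.T4Continuum.VariationalVectorRegularityCovariant (GmProj)
open Summit.QuantumFields.BalabanUV.T4Continuum.CovariantBlockReversePoincare (revPC)
open Summit.QuantumFields.BalabanUV.T4Continuum.SliceComplementFlatGap (deltaGap gapE)
open Summit.QuantumFields.BalabanUV.T4Continuum.VariationalColourTaxiTowerProjGRateData (towerLimitRate_effV_taxiTower_projG_of_data)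
open Summit.QuantumFields.BalabanUV.T4Continuum.VariationalColourTaxiTowerCentredEndData (effV_tendsto_taxiTower_projG_of_data)

variable {d : ℕ}

/-! ## §1 The twelve numeric lines hold near `(c, α, λ) = 0` -/

/-- a continuous `f : ℝ × ℝ × ℝ → ℝ` vanishing at `0` is eventually `≤ K` near `0` (`0 < K`). [folklore] -/
theorem eventually_le_of_continuous₃ {f : ℝ × ℝ × ℝ → ℝ} (hf : Continuous f) (h0 : f 0 = 0) {K : ℝ} (hK : 0 < K) :
    ∀ᶠ p in 𝓝 (0 : ℝ × ℝ × ℝ), f p ≤ K := by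
  have ht : Tendsto f (𝓝 0) (𝓝 (f 0)) := hf.tendsto 0
  rw [h0] at ht
  exact (ht.eventually_lt_const hK).mono fun _ h => h.le

/-- strict version. [folklore] -/
theorem eventually_lt_of_continuous₃ {f : ℝ × ℝ × ℝ → ℝ} (hf : Continuous f) (h0 : f 0 = 0) {K : ℝ} (hK : 0 < K) :
    ∀ᶠ p in 𝓝 (0 : ℝ × ℝ × ℝ), f p < K := by
  have ht : Tendsto f (𝓝 0) (𝓝 (f 0)) := hf.tendsto 0
  rw [h0] at ht
  exact ht.eventually_lt_const hK

variable (d) (L : ℕ)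

/-- **THE TWELVE NUMERIC LINES OF FILES 10 ∕ 11 HOLD EVENTUALLY** as `(c, α, λ) = (p.1, p.2.1, p.2.2) → 0`. [folklore] -/
theorem numeric_lines_eventually :
    ∀ᶠ p : ℝ × ℝ × ℝ in 𝓝 0,
      60 * (6 : ℝ) ^ (d - 1) * ((2 * ((((d - 1 : ℕ) : ℝ) + (d : ℝ) * d)) + 3 * ((d - 1 : ℕ) : ℝ)) * p.1) ≤ 1 / 2
      ∧ 2 * (d : ℝ) * ((((d - 1 : ℕ) : ℝ)) * p.1) ^ 2 ≤ 1 / 2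
      ∧ 64 * (2 * ((((d - 1 : ℕ) : ℝ) + (d : ℝ) * d) * p.1)) ^ 2 ≤ 1
      ∧ 80 * ((d : ℝ) * p.1) ≤ 1
      ∧ 2 * (d : ℝ) * (3 * ((d - 1 : ℕ) : ℝ) * L * p.1) ^ 2 ≤ 1 / 2
      ∧ 64 * (d : ℝ) * ((((d - 1 : ℕ) : ℝ)) * p.1) ^ 2 ≤ 1 / 2
      ∧ (18 * (d * ((d + 1 : ℝ) * Cst d 1)) + 6) * deltaGap d 1 p.2.1 p.2.2 (d * p.2.1) (((d - 1 : ℕ) : ℝ) * p.1) ^ 2 ≤ 1 / 2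
      ∧ ((d + 1 : ℝ) * Cst d 1) * (7 * (d * p.2.1 ^ 2) + 2 * (2 * ((((d - 1 : ℕ) : ℝ) + (d : ℝ) * d) * p.1) + (d * p.2.1 + p.2.1)) ^ 2) ≤ 1 / 2
      ∧ 60 * (6 : ℝ) ^ (d - 1) * ((2 * ((((d - 1 : ℕ) : ℝ)) + (d : ℝ) * d) + 5 * ((d - 1 : ℕ) : ℝ)) * p.1) ≤ 1 / 2
      ∧ (2 * ((4 * ((d : ℝ) * ((d : ℝ) * p.1)) * (4 * d * (36 : ℝ) ^ d * (1 + 3 * ((d - 1 : ℕ) : ℝ) * L * p.1) ^ 2)) ^ 2 * ((d : ℝ) * ((2 * (1 + (36 * (d * ((d + 1 : ℝ) * Cst d 1)) + 8))) + (2 * ((24 * (d * ((d + 1 : ℝ) * Cst d 1)) + 4) + d * p.1 * 64)))))) ≤ 1 / 8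
      ∧ ((3 * (((d - 1 : ℕ) : ℝ) * p.1)) ^ 2 * (max (40 * (2 * (1 + (36 * (d * ((d + 1 : ℝ) * Cst d 1)) + 8)))) (64 + 40 * (2 * ((24 * (d * ((d + 1 : ℝ) * Cst d 1)) + 4) + d * p.1 * 64))))) ≤ 1 / 4
      ∧ 60 * (6 : ℝ) ^ (d - 1) * ((2 * ((((d - 1 : ℕ) : ℝ) + (d : ℝ) * d)) + 5 * ((d - 1 : ℕ) : ℝ)) * p.1) < 1 := by
  refine (eventually_le_of_continuous₃ (by fun_prop) (by simp) (by norm_num)).and ?_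
  refine (eventually_le_of_continuous₃ (by fun_prop) (by simp) (by norm_num)).and ?_
  refine (eventually_le_of_continuous₃ (by fun_prop) (by simp) (by norm_num)).and ?_
  refine (eventually_le_of_continuous₃ (by fun_prop) (by simp) (by norm_num)).and ?_
  refine (eventually_le_of_continuous₃ (by fun_prop) (by simp) (by norm_num)).and ?_
  refine (eventually_le_of_continuous₃ (by fun_prop) (by simp) (by norm_num)).and ?_
  refine (eventually_le_of_continuous₃ (f := fun p : ℝ × ℝ × ℝ => (18 * (d * ((d + 1 : ℝ) * Cst d 1)) + 6) * deltaGap d 1 p.2.1 p.2.2 (d * p.2.1) (((d - 1 : ℕ) : ℝ) * p.1) ^ 2) ?_ ?_ (by norm_num)).and ?_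
  · unfold deltaGap gapE revPC
    fun_prop
  · simp [deltaGap, gapE]
  refine (eventually_le_of_continuous₃ (by fun_prop) (by simp) (by norm_num)).and ?_
  refine (eventually_le_of_continuous₃ (by fun_prop) (by simp) (by norm_num)).and ?_
  refine (eventually_le_of_continuous₃ (by fun_prop) (by simp) (by norm_num)).and ?_
  refine (eventually_le_of_continuous₃ (by fun_prop) (by simp) (by norm_num)).and ?_
  exact eventually_lt_of_continuous₃ (by fun_prop) (by simp) (by norm_num)

/-- **ONE THRESHOLD**: `∃ c₀ > 0` (depending on `d`, `L` only) such that the twelve lines hold whenever `|c|, |α|, |λ| < c₀`. [folklore] -/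
theorem numeric_lines_of_small :
    ∃ c₀ : ℝ, 0 < c₀ ∧ ∀ c α lam : ℝ, |c| < c₀ → |α| < c₀ → |lam| < c₀ →
      60 * (6 : ℝ) ^ (d - 1) * ((2 * ((((d - 1 : ℕ) : ℝ) + (d : ℝ) * d)) + 3 * ((d - 1 : ℕ) : ℝ)) * c) ≤ 1 / 2
      ∧ 2 * (d : ℝ) * ((((d - 1 : ℕ) : ℝ)) * c) ^ 2 ≤ 1 / 2
      ∧ 64 * (2 * ((((d - 1 : ℕ) : ℝ) + (d : ℝ) * d) * c)) ^ 2 ≤ 1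
      ∧ 80 * ((d : ℝ) * c) ≤ 1
      ∧ 2 * (d : ℝ) * (3 * ((d - 1 : ℕ) : ℝ) * L * c) ^ 2 ≤ 1 / 2
      ∧ 64 * (d : ℝ) * ((((d - 1 : ℕ) : ℝ)) * c) ^ 2 ≤ 1 / 2
      ∧ (18 * (d * ((d + 1 : ℝ) * Cst d 1)) + 6) * deltaGap d 1 α lam (d * α) (((d - 1 : ℕ) : ℝ) * c) ^ 2 ≤ 1 / 2
      ∧ ((d + 1 : ℝ) * Cst d 1) * (7 * (d * α ^ 2) + 2 * (2 * ((((d - 1 : ℕ) : ℝ) + (d : ℝ) * d) * c) + (d * α + α)) ^ 2) ≤ 1 / 2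
      ∧ 60 * (6 : ℝ) ^ (d - 1) * ((2 * ((((d - 1 : ℕ) : ℝ)) + (d : ℝ) * d) + 5 * ((d - 1 : ℕ) : ℝ)) * c) ≤ 1 / 2
      ∧ (2 * ((4 * ((d : ℝ) * ((d : ℝ) * c)) * (4 * d * (36 : ℝ) ^ d * (1 + 3 * ((d - 1 : ℕ) : ℝ) * L * c) ^ 2)) ^ 2 * ((d : ℝ) * ((2 * (1 + (36 * (d * ((d + 1 : ℝ) * Cst d 1)) + 8))) + (2 * ((24 * (d * ((d + 1 : ℝ) * Cst d 1)) + 4) + d * c * 64)))))) ≤ 1 / 8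
      ∧ ((3 * (((d - 1 : ℕ) : ℝ) * c)) ^ 2 * (max (40 * (2 * (1 + (36 * (d * ((d + 1 : ℝ) * Cst d 1)) + 8)))) (64 + 40 * (2 * ((24 * (d * ((d + 1 : ℝ) * Cst d 1)) + 4) + d * c * 64))))) ≤ 1 / 4
      ∧ 60 * (6 : ℝ) ^ (d - 1) * ((2 * ((((d - 1 : ℕ) : ℝ) + (d : ℝ) * d)) + 5 * ((d - 1 : ℕ) : ℝ)) * c) < 1 := by
  obtain ⟨ε, hε, h⟩ := Metric.eventually_nhds_iff.mp (numeric_lines_eventually d L)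
  refine ⟨ε, hε, fun c α lam hc hα hl => ?_⟩
  have hd : dist ((c, α, lam) : ℝ × ℝ × ℝ) 0 < ε := by
    rw [Prod.dist_eq, Prod.dist_eq]
    simp only [Prod.fst_zero, Prod.snd_zero, Real.dist_eq, sub_zero]
    exact max_lt hc (max_lt hα hl)
  exact h hd

/-! ## §2 The RATE END for all small class constants -/

section Taxi

variable {d} [NeZero L] (M : Fin d → ℕ) [hM : ∀ μ, NeZero (M μ)]

omit hM in
/-- the class constants are nonnegative (they dominate norms). [folklore] -/
theorem consts_nonneg (hd : 1 ≤ d) {R' : (k : ℕ) → Tor (fine L (fine (L ^ k) M)) → Fin d → (ℂ →L[ℂ] ℂ)} {b : ℕ → ℝ} {c : ℝ}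
    (hb : ∀ k x κ ι, ‖R' k x κ * R' k (x + unitVec (fine L (fine (L ^ k) M)) κ) ι - R' k x ι * R' k (x + unitVec (fine L (fine (L ^ k) M)) ι) κ‖ ≤ b k)
    (hbc : ∀ k, (((L ^ (k + 1) : ℕ)) : ℝ) ^ 2 * b k ≤ c)
    {ar ℓr : ℕ → ℝ} {α lam : ℝ} (har0 : ∀ k, 0 ≤ ar k)
    (hℓr : ∀ k x μ, ‖Rlev L M R' k x μ - Rlev L M R' k (x - unitVec (fine (L ^ k) M) μ) μ‖ ≤ ℓr k)
    (hα : ∀ k, (((L ^ k : ℕ)) : ℝ) * ar k ≤ α) (hlam : ∀ k, (((L ^ k : ℕ)) : ℝ) ^ 2 * ℓr k ≤ lam) :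
    0 ≤ c ∧ 0 ≤ α ∧ 0 ≤ lam := by
  have hb0 : 0 ≤ b 0 := (norm_nonneg _).trans (hb 0 0 ⟨0, hd⟩ ⟨0, hd⟩)
  have hℓ0 : 0 ≤ ℓr 0 := (norm_nonneg _).trans (hℓr 0 0 ⟨0, hd⟩)
  refine ⟨le_trans (by positivity) (hbc 0), le_trans ?_ (hα 0), le_trans (by positivity) (hlam 0)⟩
  have := har0 0
  positivity

/-- **THE VECTOR END WITH RATE AT BAŁABAN's TAXI DATA, FOR ALL SMALL CLASS CONSTANTS** — file 10's END with its eleven numeric lines replaced by ONE threshold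
`c₀(d, L) > 0` on `c, α, λ`; the END's constant is existential here (its explicit form is file 10's). [folklore] -/
theorem towerLimitRate_effV_taxiTower_projG_of_small (hL : 2 ≤ L) (hd : 1 ≤ d) :
    ∃ c₀ : ℝ, 0 < c₀ ∧ ∀ {M : Fin d → ℕ} [∀ μ, NeZero (M μ)], (∀ μ, 1 < M μ) →
      ∀ {R' : (k : ℕ) → Tor (fine L (fine (L ^ k) M)) → Fin d → (ℂ →L[ℂ] ℂ)}, (∀ k x μ, R' k x μ ∈ unitary (ℂ →L[ℂ] ℂ)) →
      ∀ {b : ℕ → ℝ} {c : ℝ},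
        (∀ k x κ ι, ‖R' k x κ * R' k (x + unitVec (fine L (fine (L ^ k) M)) κ) ι - R' k x ι * R' k (x + unitVec (fine L (fine (L ^ k) M)) ι) κ‖ ≤ b k) →
        (∀ k, (((L ^ (k + 1) : ℕ)) : ℝ) ^ 2 * b k ≤ c) →
        (∀ k, coarseTv L (fine (L ^ (k + 1)) M) (R' (k + 1)) = Rtrv (L ^ k) L M (R' k)) →
      ∀ {ar ℓr : ℕ → ℝ} {α lam : ℝ}, (∀ k, 0 ≤ ar k) → (∀ k x μ, ‖Rlev L M R' k x μ - 1‖ ≤ ar k) →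
        (∀ k x μ, ‖Rlev L M R' k x μ - Rlev L M R' k (x - unitVec (fine (L ^ k) M) μ) μ‖ ≤ ℓr k) →
        (∀ k, (((L ^ k : ℕ)) : ℝ) * ar k ≤ α) → (∀ k, (((L ^ k : ℕ)) : ℝ) ^ 2 * ℓr k ≤ lam) →
      c < c₀ → α < c₀ → lam < c₀ →
      ∀ {aa : ℝ}, 0 < aa → ∀ {θ : ℝ}, 0 < θ → (L : ℝ)⁻¹ ≤ θ ^ 2 → θ < 1 →
        ∃ C : ℝ, TowerLimitRate (ι := fun _ => Tor M × Fin d) (fun _ => (1 : Matrix (Tor M × Fin d) (Tor M × Fin d) ℂ)) 1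
          (fun k => effV (L ^ k) M (Rlev L M R' k)
            (GmProj (fine (L ^ k) M) (Rlev L M R' k) (LinearMap.ker (avgOp (L ^ k) M (taxiTv (L ^ k) M (Rlev L M R' k))))) (QmL (L ^ k) M (nestLv L M R' k)) aa)
          C θ := by
  obtain ⟨c₀, hc₀, hlines⟩ := numeric_lines_of_small d L
  refine ⟨c₀, hc₀, ?_⟩
  intro M _ hM2 R' hU b c hb hbc hcoh ar ℓr α lam har0 har hℓr hα hlam hc hαc hlc aa haa θ hθ0 hθL hθ1
  obtain ⟨h0c, h0α, h0l⟩ := consts_nonneg L M hd hb hbc har0 hℓr hα hlam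
  obtain ⟨hsm1, hsm2, hsm3, hsm4, hsm5, hsm6, hsmallδ, hsmallQ, hsm7, hsmV, hsmG, -⟩ :=
    hlines c α lam (by rwa [abs_of_nonneg h0c]) (by rwa [abs_of_nonneg h0α]) (by rwa [abs_of_nonneg h0l])
  exact ⟨_, towerLimitRate_effV_taxiTower_projG_of_data L M hL hd hM2 hU hb hbc hcoh hsm1 hsm2 hsm3 hsm4 hsm5 hsm6 har0 har hℓr hα hlam hsmallδ hsmallQ
    haa hθ0 hθL hθ1 hsm7 hsmV hsmG⟩

/-! ## §3 The EXISTENCE END for all small class constants -/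

/-- **THE VECTOR TOWER LIMIT AT BAŁABAN's TAXI DATA EXISTS, FOR ALL SMALL CLASS CONSTANTS** — file 11's END with its twelve numeric lines replaced by the same
threshold `c₀(d, L) > 0`. [folklore] -/
theorem effV_tendsto_taxiTower_projG_of_small (hL : 2 ≤ L) (hd : 1 ≤ d) :
    ∃ c₀ : ℝ, 0 < c₀ ∧ ∀ {M : Fin d → ℕ} [∀ μ, NeZero (M μ)], (∀ μ, 1 < M μ) →
      ∀ {R' : (k : ℕ) → Tor (fine L (fine (L ^ k) M)) → Fin d → (ℂ →L[ℂ] ℂ)}, (∀ k x μ, R' k x μ ∈ unitary (ℂ →L[ℂ] ℂ)) →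
      ∀ {b : ℕ → ℝ} {c : ℝ},
        (∀ k x κ ι, ‖R' k x κ * R' k (x + unitVec (fine L (fine (L ^ k) M)) κ) ι - R' k x ι * R' k (x + unitVec (fine L (fine (L ^ k) M)) ι) κ‖ ≤ b k) →
        (∀ k, (((L ^ (k + 1) : ℕ)) : ℝ) ^ 2 * b k ≤ c) →
        (∀ k, coarseTv L (fine (L ^ (k + 1)) M) (R' (k + 1)) = Rtrv (L ^ k) L M (R' k)) →
      ∀ {ar ℓr : ℕ → ℝ} {α lam : ℝ}, (∀ k, 0 ≤ ar k) → (∀ k x μ, ‖Rlev L M R' k x μ - 1‖ ≤ ar k) →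
        (∀ k x μ, ‖Rlev L M R' k x μ - Rlev L M R' k (x - unitVec (fine (L ^ k) M) μ) μ‖ ≤ ℓr k) →
        (∀ k, (((L ^ k : ℕ)) : ℝ) * ar k ≤ α) → (∀ k, (((L ^ k : ℕ)) : ℝ) ^ 2 * ℓr k ≤ lam) →
      c < c₀ → α < c₀ → lam < c₀ →
      ∀ {aa : ℝ}, 0 < aa →
    ∃ Xlim : Matrix (Tor M × Fin d) (Tor M × Fin d) ℂ,
      Tendsto (fun k => effV (L ^ k) M (Rlev L M R' k)
        (GmProj (fine (L ^ k) M) (Rlev L M R' k) (LinearMap.ker (avgOp (L ^ k) M (taxiTv (L ^ k) M (Rlev L M R' k))))) (QmL (L ^ k) M (nestLv L M R' k)) aa)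
        atTop (𝓝 Xlim) ∧ Xlim.IsHermitian ∧ (∀ v, 0 ≤ qform Xlim v) ∧
      ∀ φ : Tor M → Fin d → ℂ, Tendsto (fun k => blockSpin (QvL (L ^ k) M (nestLv L M R' k))
        (ScV (L ^ k) M (Rlev L M R' k) (projG (fine (L ^ k) M) (Rlev L M R' k) (LinearMap.ker (avgOp (L ^ k) M (taxiTv (L ^ k) M (Rlev L M R' k)))))) φ)
        atTop (𝓝 (qform Xlim (unc φ))) := by
  obtain ⟨c₀, hc₀, hlines⟩ := numeric_lines_of_small d L
  refine ⟨c₀, hc₀, ?_⟩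
  intro M _ hM2 R' hU b c hb hbc hcoh ar ℓr α lam har0 har hℓr hα hlam hc hαc hlc aa haa
  obtain ⟨h0c, h0α, h0l⟩ := consts_nonneg L M hd hb hbc har0 hℓr hα hlam
  have hb0 : ∀ k, 0 ≤ b k := fun k => (norm_nonneg _).trans (hb k 0 ⟨0, hd⟩ ⟨0, hd⟩)
  obtain ⟨hsm1, hsm2, hsm3, hsm4, -, hsm6, hsmallδ, hsmallQ, hsm7, hsmV, hsmG, hlt⟩ :=
    hlines c α lam (by rwa [abs_of_nonneg h0c]) (by rwa [abs_of_nonneg h0α]) (by rwa [abs_of_nonneg h0l])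
  exact effV_tendsto_taxiTower_projG_of_data L M hL hd hM2 hU hb hb0 hbc hcoh hsm1 hsm2 hsm3 hsm4 hsm6 hlt har0 har hℓr hα hlam hsmallδ hsmallQ
    haa hsm7 hsmV hsmG

end Taxi

end Summit.QuantumFields.BalabanUV.T4Continuum.VariationalColourTaxiTowerEndSmall

end
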